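/-
Copyright: the b2b-balaban T⁴-continuum CRUX team, row NE7b OWNER lineage `t4-ne7b-p1` (gen 138). Project licence.
-/
import Mathlib.Analysis.InnerProductSpace.PiL2
import Mathlib.Algebra.Order.BigOperators.Group.Finset
import Mathlib.Algebra.BigOperators.Group.Finset.Sigma

/-!
# KERNEL (ROW-SUM) LETTERS — THE FORMAT THAT DECAY ESTIMATES PRODUCE, THAT DOMINATES BOTH THE EUCLIDEAN OPERATOR LETTERS (Schur) AND
# THE SUP-NORM LETTERS (431), AND THAT TRANSPORTS THROUGH THE CANONICAL RESCALING `A = t • J_β` BY EXACT POWER COUNTING `n·|t|^k`: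
# a `k`-linear letter given by a kernel `T_{x₁…x_k}` on the fine sites with ROW SUMS `sup_{x₁} Σ_{x₂…x_k} |T| ≤ κ` becomes, on the
# coarse sites, the kernel `t^k·Σ_{fibres} T` with row sums `≤ |t|^k·n·κ` (`n` = sites per block) — `L²` at order `2`, `L` at order `3`
# in `d = 4` (against (428)'s operator-norm `L²`, `L³`): the LETTER FORMAT DECISION of SCOPING (d10) (row NE7b, node U5c; Mathlib only;
# [folklore] finite sums)

Cell `pub-balaban`, sub-cell `t4`, spine estimate NE7b (`T4WeightBudget.RelWeightBound`; the cell's OWN estimate — NOT PRINTED in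
[Bałaban 1983–89], NOT PROVED).  Crux-route work under `Spine/NE7b/` by the row OWNER (`t4-ne7b-p1` gen 138, file (433)) under FREEZE
(0)'s crux-prover clause; NOTHING of Bałaban's is named as a Lean object, valued or asserted; no `T4Continuum/Support` leaf typed; no
`def`, no notation; zero `sorry`.  Imports: Mathlib only (fast lane); (429) (the block map `β` with fibres of `≤ n` sites, the field
normalisation `t`) and (431) (sup-norm letters) are met BY SHAPE.

WHY ((430) NO, (431) YES-format, and the lineage's decay machinery (SupTorus…Decay, SupZd…, Combes–Thomas files)).  Three letter
formats are now on the table for a `k`-linear piece of a potential: (E) the Euclidean operator norm of (399)–(428) (what Brascamp–Lieb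
and the Gaussian calculus give; transports by `‖A‖^k = L^k`, too lossy to iterate); (S) the sup-norm letters of (431) (transport by
`|t|^k` exactly, extensive; but nothing in the fluctuation step produces them directly); (K) KERNEL letters: the piece is
`Σ T_{x₁…x_k} h¹_{x₁}⋯h^k_{x_k}` with a row-sum bound `sup_{x₁} Σ |T_{x₁…}| ≤ κ`.  (K) is what every DECAY estimate of the road yields
(`|T_{xy}| ≤ κ₀·w(x,y)` with summable weights `Σ_y w ≤ C` gives `κ = κ₀C`, §1), it DOMINATES (E) (Schur's test, §2: rows and columns
`≤ κ` ⟹ `|B[h,k]| ≤ κ` on the Euclidean unit ball) and (S) (§3: `|Σ_{x∈Y}Σ_y T h k| ≤ |Y|·κ` on unit sup-balls — extensive with the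
right count), and it TRANSPORTS through `t • J_β` with the factor `|t|^k·n` per coarse row (§4–§5), i.e. by exact power counting, because
a coarse row collects ONE block of `n` fine rows and the fibre sums partition the remaining indices.  Hence the class of (d10) should
carry KERNEL letters at orders `2 … k_max` (with decay weights), the small-field radius, and the extracted couplings; the Euclidean
letters needed inside a fluctuation step (floors, Brascamp–Lieb) are then READ OFF by Schur, never transported.

WHAT IS PROVED ([folklore]; `T : ι → ι → ℝ`, `T₃ : ι → ι → ι → ℝ` kernels on finite types; `β : ι → ι′` with fibres of `≤ n` sites):
* §1 `rowsum_nonneg_bound` (`κ ≥ 0` once a row-sum letter holds on a nonempty type), `rowsum_of_decay` (`|T x y| ≤ κ₀ w x y`, `Σ_y w x y ≤ C`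
  ⟹ rows `≤ κ₀C`).
* §2 SCHUR: `schur_amgm` (rows, columns `≤ κ` ⟹ `|Σ T h k| ≤ κ∕2·(Σh² + Σk²)`), `schur_unit_ball` (`Σh² ≤ 1`, `Σk² ≤ 1 ⟹ |Σ T h k| ≤ κ`).
* §3 SUP-NORM LETTERS FROM ROW SUMS: `sup_letter_of_rowsum` (`|Σ_{x∈Y}Σ_y T h k| ≤ |Y|·κ` for `|h|_∞, |k|_∞ ≤ 1`), `sup_letter3_of_rowsum`.
* §4 TRANSPORT, ORDER 2: `coarse_kernel_rowsum_le` (the coarse kernel `t²Σ_{βx=y₁}Σ_{βx′=y₂}T x x′` has rows `≤ t²·n·κ`, `κ ≥ 0`),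
  `coarse_kernel_represents` (it IS the kernel of the composed form: `Σ_{x,x′} T (Av)_x (Aw)_{x′} = Σ_{y₁,y₂} T′ v w`).
* §5 TRANSPORT, ORDER 3: `coarse_kernel3_rowsum_le` (rows `≤ |t|³·n·κ₃`).
* §6 toy (kernel): the identity kernel on `Fin 2` has row sums `1`.

HONEST (what this is NOT).  The format decision's bookkeeping only: NO decay estimate is proved here (the road's Combes–Thomas ∕
random-walk files supply `w` and `C`), the fluctuation step is NOT re-run in kernel letters (that is (β3′): the dressed covariance's
decay inside and across blocks feeding §1), and the extraction∕radius∕large-field parts of (β4) are (432) and beyond.  Scalar skeleton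
((A3), NC-NE7b-α UNRULED); nothing of Bałaban's asserted.  BY-NAME EFFECT ON THE WALL: NONE.  NE7b NOT PRINTED ∕ NOT PROVED; spine PROVED
0∕9; rung (B)+1 — the programme's measures remain FINITE-torus statements; NOT the mass gap, NOT Clay.  HONEST DEPENDENCY: continuum YM
on T⁴ ⇐ BetaPertH ∧ nine spine estimates (0∕9 proved); BetaPertH ⇐ (D1) ∧ (D4) ∧ CAP+tail; G-an2-4 gates asym, D1 and NE2∕3∕4.
-/

set_option autoImplicit false

noncomputable section

namespace Summit.QuantumFields.BalabanUV.T4Continuum.NE7b.SupKernelLetterTransport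

open Finset Real
open scoped BigOperators

variable {ι ι' : Type} [Fintype ι] [Fintype ι'] [DecidableEq ι']

/-! ## §1. Row-sum letters and where they come from -/

omit [Fintype ι'] [DecidableEq ι'] in
/-- A row-sum letter on a nonempty index type forces `κ ≥ 0`. [folklore] -/
theorem rowsum_nonneg_bound (T : ι → ι → ℝ) {κ : ℝ} (hrow : ∀ x, ∑ x', |T x x'| ≤ κ) (x₀ : ι) : 0 ≤ κ :=
  (Finset.sum_nonneg fun x' _ => abs_nonneg (T x₀ x')).trans (hrow x₀)

omit [Fintype ι'] [DecidableEq ι'] in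
/-- **DECAY GIVES ROW SUMS**: `|T x y| ≤ κ₀·w x y` with summable weights `Σ_y w x y ≤ C` (`κ₀ ≥ 0`) gives the row-sum letter `κ₀·C`. [folklore] -/
theorem rowsum_of_decay (T w : ι → ι → ℝ) {κ₀ C : ℝ} (hκ₀ : 0 ≤ κ₀) (hT : ∀ x y, |T x y| ≤ κ₀ * w x y) (hw : ∀ x, ∑ y, w x y ≤ C) :
    ∀ x, ∑ y, |T x y| ≤ κ₀ * C := by
  intro x
  calc ∑ y, |T x y| ≤ ∑ y, κ₀ * w x y := Finset.sum_le_sum fun y _ => hT x y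
    _ = κ₀ * ∑ y, w x y := by rw [Finset.mul_sum]
    _ ≤ κ₀ * C := mul_le_mul_of_nonneg_left (hw x) hκ₀

/-! ## §2. Schur: kernel letters dominate the Euclidean operator letters -/

omit [Fintype ι'] [DecidableEq ι'] in
/-- **SCHUR, AM–GM FORM**: rows and columns `≤ κ` give `|Σ_{x,y} T x y·h x·k y| ≤ κ∕2·(Σ_x h_x² + Σ_y k_y²)`. [folklore] -/
theorem schur_amgm (T : ι → ι → ℝ) {κ : ℝ} (hrow : ∀ x, ∑ y, |T x y| ≤ κ) (hcol : ∀ y, ∑ x, |T x y| ≤ κ) (h k : ι → ℝ) :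
    |∑ x, ∑ y, T x y * h x * k y| ≤ κ / 2 * (∑ x, h x ^ 2 + ∑ y, k y ^ 2) := by
  have h1 : |∑ x, ∑ y, T x y * h x * k y| ≤ ∑ x, ∑ y, |T x y| * (h x ^ 2 / 2 + k y ^ 2 / 2) := by
    refine (Finset.abs_sum_le_sum_abs _ _).trans (Finset.sum_le_sum fun x _ => ?_)
    refine (Finset.abs_sum_le_sum_abs _ _).trans (Finset.sum_le_sum fun y _ => ?_)
    rw [abs_mul, abs_mul]
    have hamgm : |h x| * |k y| ≤ h x ^ 2 / 2 + k y ^ 2 / 2 := by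
      have := two_mul_le_add_sq (|h x|) (|k y|)
      rw [sq_abs, sq_abs] at this
      linarith
    calc |T x y| * |h x| * |k y| = |T x y| * (|h x| * |k y|) := by ring
      _ ≤ |T x y| * (h x ^ 2 / 2 + k y ^ 2 / 2) := mul_le_mul_of_nonneg_left hamgm (abs_nonneg _)
  have h2 : ∑ x, ∑ y, |T x y| * (h x ^ 2 / 2 + k y ^ 2 / 2) =
      (∑ x, h x ^ 2 / 2 * ∑ y, |T x y|) + ∑ y, k y ^ 2 / 2 * ∑ x, |T x y| := by
    have hsplit : ∀ x, ∑ y, |T x y| * (h x ^ 2 / 2 + k y ^ 2 / 2) = h x ^ 2 / 2 * ∑ y, |T x y| + ∑ y, k y ^ 2 / 2 * |T x y| := by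
      intro x
      rw [Finset.mul_sum, ← Finset.sum_add_distrib]
      refine Finset.sum_congr rfl fun y _ => ?_
      ring
    simp only [hsplit]
    rw [Finset.sum_add_distrib, Finset.sum_comm]
    congr 1
    refine Finset.sum_congr rfl fun y _ => ?_
    rw [Finset.mul_sum]
  have h3 : (∑ x, h x ^ 2 / 2 * ∑ y, |T x y|) ≤ ∑ x, h x ^ 2 / 2 * κ :=
    Finset.sum_le_sum fun x _ => mul_le_mul_of_nonneg_left (hrow x) (by positivity)
  have h4 : (∑ y, k y ^ 2 / 2 * ∑ x, |T x y|) ≤ ∑ y, k y ^ 2 / 2 * κ :=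
    Finset.sum_le_sum fun y _ => mul_le_mul_of_nonneg_left (hcol y) (by positivity)
  rw [h2] at h1
  have h5 : (∑ x, h x ^ 2 / 2 * κ) + ∑ y, k y ^ 2 / 2 * κ = κ / 2 * (∑ x, h x ^ 2 + ∑ y, k y ^ 2) := by
    rw [← Finset.sum_mul, ← Finset.sum_mul, ← Finset.sum_div, ← Finset.sum_div]
    ring
  linarith

omit [Fintype ι'] [DecidableEq ι'] in
/-- **SCHUR ON THE EUCLIDEAN UNIT BALL**: rows and columns `≤ κ`, `Σh² ≤ 1`, `Σk² ≤ 1 ⟹ |Σ T h k| ≤ κ` — the kernel letter dominates the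
Euclidean operator letter of (399)–(428). [folklore] -/
theorem schur_unit_ball (T : ι → ι → ℝ) {κ : ℝ} (hrow : ∀ x, ∑ y, |T x y| ≤ κ) (hcol : ∀ y, ∑ x, |T x y| ≤ κ) (h k : ι → ℝ)
    (hh : ∑ x, h x ^ 2 ≤ 1) (hk : ∑ y, k y ^ 2 ≤ 1) (hκ : 0 ≤ κ) : |∑ x, ∑ y, T x y * h x * k y| ≤ κ := by
  have h1 := schur_amgm T hrow hcol h k
  nlinarith

/-! ## §3. Sup-norm letters from row sums -/

omit [Fintype ι'] [DecidableEq ι'] in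
/-- **ROW SUMS GIVE THE (EXTENSIVE) SUP-NORM LETTER**: `|Σ_{x∈Y}Σ_y T x y·h x·k y| ≤ |Y|·κ` for `|h|_∞, |k|_∞ ≤ 1`. [folklore] -/
theorem sup_letter_of_rowsum (T : ι → ι → ℝ) {κ : ℝ} (hrow : ∀ x, ∑ y, |T x y| ≤ κ) (Y : Finset ι) (h k : ι → ℝ)
    (hh : ∀ x, |h x| ≤ 1) (hk : ∀ y, |k y| ≤ 1) : |∑ x ∈ Y, ∑ y, T x y * h x * k y| ≤ Y.card * κ := by
  have h1 : ∀ x, |∑ y, T x y * h x * k y| ≤ κ := by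
    intro x
    refine (Finset.abs_sum_le_sum_abs _ _).trans ((Finset.sum_le_sum fun y _ => ?_).trans (hrow x))
    rw [abs_mul, abs_mul]
    calc |T x y| * |h x| * |k y| ≤ |T x y| * 1 * 1 := by gcongr <;> first | exact hh x | exact hk y
      _ = |T x y| := by ring
  calc |∑ x ∈ Y, ∑ y, T x y * h x * k y| ≤ ∑ x ∈ Y, |∑ y, T x y * h x * k y| := Finset.abs_sum_le_sum_abs _ _
    _ ≤ ∑ x ∈ Y, κ := Finset.sum_le_sum fun x _ => h1 x
    _ = Y.card * κ := by rw [Finset.sum_const, nsmul_eq_mul]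

omit [Fintype ι'] [DecidableEq ι'] in
/-- **Order 3**: `|Σ_{x∈Y}Σ_{y,z} T₃ x y z·a x·b y·c z| ≤ |Y|·κ₃` for unit sup-ball test vectors, given `Σ_{y,z}|T₃ x y z| ≤ κ₃` for all `x`. [folklore] -/
theorem sup_letter3_of_rowsum (T₃ : ι → ι → ι → ℝ) {κ₃ : ℝ} (hrow : ∀ x, ∑ y, ∑ z, |T₃ x y z| ≤ κ₃) (Y : Finset ι) (a b c : ι → ℝ)
    (ha : ∀ x, |a x| ≤ 1) (hb : ∀ y, |b y| ≤ 1) (hc : ∀ z, |c z| ≤ 1) :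
    |∑ x ∈ Y, ∑ y, ∑ z, T₃ x y z * a x * b y * c z| ≤ Y.card * κ₃ := by
  have h1 : ∀ x, |∑ y, ∑ z, T₃ x y z * a x * b y * c z| ≤ κ₃ := by
    intro x
    refine (Finset.abs_sum_le_sum_abs _ _).trans ((Finset.sum_le_sum fun y _ => ?_).trans (hrow x))
    refine (Finset.abs_sum_le_sum_abs _ _).trans (Finset.sum_le_sum fun z _ => ?_)
    rw [abs_mul, abs_mul, abs_mul]
    calc |T₃ x y z| * |a x| * |b y| * |c z| ≤ |T₃ x y z| * 1 * 1 * 1 := by gcongr <;> first | exact ha x | exact hb y | exact hc z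
      _ = |T₃ x y z| := by ring
  calc |∑ x ∈ Y, ∑ y, ∑ z, T₃ x y z * a x * b y * c z| ≤ ∑ x ∈ Y, |∑ y, ∑ z, T₃ x y z * a x * b y * c z| := Finset.abs_sum_le_sum_abs _ _
    _ ≤ ∑ x ∈ Y, κ₃ := Finset.sum_le_sum fun x _ => h1 x
    _ = Y.card * κ₃ := by rw [Finset.sum_const, nsmul_eq_mul]

/-! ## §4. Transport through `t • J_β`, order 2: the coarse kernel and its row sums -/

/-- **THE COARSE KERNEL'S ROW SUMS — EXACT POWER COUNTING AT ORDER 2**: for fibres of `≤ n` sites and fine rows `≤ κ`, the coarse kernel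
`T′ y₁ y₂ = t²·Σ_{βx=y₁}Σ_{βx′=y₂} T x x′` has rows `Σ_{y₂}|T′ y₁ y₂| ≤ t²·n·κ` (a coarse row collects one block of fine rows; the fibres
partition the column index). [folklore] -/
theorem coarse_kernel_rowsum_le (β : ι → ι') {n : ℕ} (hfib : ∀ y, (Finset.univ.filter fun x => β x = y).card ≤ n) (T : ι → ι → ℝ)
    {κ : ℝ} (hκ : 0 ≤ κ) (hrow : ∀ x, ∑ x', |T x x'| ≤ κ) (t : ℝ) (y₁ : ι') :
    ∑ y₂, |t ^ 2 * ∑ x ∈ Finset.univ.filter (fun x => β x = y₁), ∑ x' ∈ Finset.univ.filter (fun x' => β x' = y₂), T x x'| ≤ t ^ 2 * n * κ := by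
  calc ∑ y₂, |t ^ 2 * ∑ x ∈ Finset.univ.filter (fun x => β x = y₁), ∑ x' ∈ Finset.univ.filter (fun x' => β x' = y₂), T x x'|
      ≤ ∑ y₂, t ^ 2 * ∑ x ∈ Finset.univ.filter (fun x => β x = y₁), ∑ x' ∈ Finset.univ.filter (fun x' => β x' = y₂), |T x x'| := by
        refine Finset.sum_le_sum fun y₂ _ => ?_
        rw [abs_mul, abs_of_nonneg (sq_nonneg t)]
        refine mul_le_mul_of_nonneg_left ?_ (sq_nonneg t)
        exact (Finset.abs_sum_le_sum_abs _ _).trans (Finset.sum_le_sum fun x _ => Finset.abs_sum_le_sum_abs _ _)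
    _ = t ^ 2 * ∑ x ∈ Finset.univ.filter (fun x => β x = y₁), ∑ y₂, ∑ x' ∈ Finset.univ.filter (fun x' => β x' = y₂), |T x x'| := by
        rw [← Finset.mul_sum, Finset.sum_comm]
    _ = t ^ 2 * ∑ x ∈ Finset.univ.filter (fun x => β x = y₁), ∑ x', |T x x'| := by
        congr 1
        refine Finset.sum_congr rfl fun x _ => ?_
        exact Finset.sum_fiberwise Finset.univ β fun x' => |T x x'|
    _ ≤ t ^ 2 * ∑ x ∈ Finset.univ.filter (fun x => β x = y₁), κ := by
        gcongr with x _
        exact hrow x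
    _ = t ^ 2 * ((Finset.univ.filter fun x => β x = y₁).card * κ) := by rw [Finset.sum_const, nsmul_eq_mul]
    _ ≤ t ^ 2 * (n * κ) := mul_le_mul_of_nonneg_left (mul_le_mul_of_nonneg_right (by exact_mod_cast hfib y₁) hκ) (sq_nonneg t)
    _ = t ^ 2 * n * κ := by ring

omit [DecidableEq ι'] in
/-- **THE COARSE KERNEL REPRESENTS THE COMPOSED FORM**: with `(Av)_x = t·v(βx)`,
`Σ_{x,x′} T x x′·(Av)_x·(Aw)_{x′} = Σ_{y₁,y₂} (t²Σ_{βx=y₁}Σ_{βx′=y₂} T x x′)·v y₁·w y₂`. [folklore] -/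
theorem coarse_kernel_represents [DecidableEq ι'] (β : ι → ι') (T : ι → ι → ℝ) (t : ℝ) (v w : ι' → ℝ) :
    ∑ x, ∑ x', T x x' * (t * v (β x)) * (t * w (β x')) =
      ∑ y₁, ∑ y₂, (t ^ 2 * ∑ x ∈ Finset.univ.filter (fun x => β x = y₁), ∑ x' ∈ Finset.univ.filter (fun x' => β x' = y₂), T x x') * v y₁ * w y₂ := by
  symm
  calc ∑ y₁, ∑ y₂, (t ^ 2 * ∑ x ∈ Finset.univ.filter (fun x => β x = y₁), ∑ x' ∈ Finset.univ.filter (fun x' => β x' = y₂), T x x') * v y₁ * w y₂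
      = ∑ y₁, ∑ y₂, ∑ x ∈ Finset.univ.filter (fun x => β x = y₁), ∑ x' ∈ Finset.univ.filter (fun x' => β x' = y₂),
          T x x' * (t * v y₁) * (t * w y₂) := by
        refine Finset.sum_congr rfl fun y₁ _ => Finset.sum_congr rfl fun y₂ _ => ?_
        rw [Finset.mul_sum, Finset.sum_mul, Finset.sum_mul]
        refine Finset.sum_congr rfl fun x _ => ?_
        rw [Finset.mul_sum, Finset.sum_mul, Finset.sum_mul]
        refine Finset.sum_congr rfl fun x' _ => ?_
        ring
    _ = ∑ y₁, ∑ x ∈ Finset.univ.filter (fun x => β x = y₁), ∑ y₂, ∑ x' ∈ Finset.univ.filter (fun x' => β x' = y₂),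
          T x x' * (t * v y₁) * (t * w y₂) := by
        refine Finset.sum_congr rfl fun y₁ _ => ?_
        rw [Finset.sum_comm]
    _ = ∑ y₁, ∑ x ∈ Finset.univ.filter (fun x => β x = y₁), ∑ y₂, ∑ x' ∈ Finset.univ.filter (fun x' => β x' = y₂),
          T x x' * (t * v (β x)) * (t * w (β x')) := by
        refine Finset.sum_congr rfl fun y₁ _ => Finset.sum_congr rfl fun x hx => ?_
        refine Finset.sum_congr rfl fun y₂ _ => Finset.sum_congr rfl fun x' hx' => ?_
        rw [(Finset.mem_filter.1 hx).2, (Finset.mem_filter.1 hx').2]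
    _ = ∑ y₁, ∑ x ∈ Finset.univ.filter (fun x => β x = y₁), ∑ x', T x x' * (t * v (β x)) * (t * w (β x')) := by
        refine Finset.sum_congr rfl fun y₁ _ => Finset.sum_congr rfl fun x _ => ?_
        exact Finset.sum_fiberwise Finset.univ β fun x' => T x x' * (t * v (β x)) * (t * w (β x'))
    _ = ∑ x, ∑ x', T x x' * (t * v (β x)) * (t * w (β x')) :=
        Finset.sum_fiberwise Finset.univ β fun x => ∑ x', T x x' * (t * v (β x)) * (t * w (β x'))

/-! ## §5. Transport, order 3 -/

/-- **EXACT POWER COUNTING AT ORDER 3**: fine rows `Σ_{y,z}|T₃ x y z| ≤ κ₃` and fibres of `≤ n` sites give coarse rows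
`Σ_{y₂,y₃}|t³·Σ_{fibres} T₃| ≤ |t|³·n·κ₃` — `L·κ₃` at `d = 4`, where the operator-norm transport (428) pays `L³`. [folklore] -/
theorem coarse_kernel3_rowsum_le (β : ι → ι') {n : ℕ} (hfib : ∀ y, (Finset.univ.filter fun x => β x = y).card ≤ n)
    (T₃ : ι → ι → ι → ℝ) {κ₃ : ℝ} (hκ₃ : 0 ≤ κ₃) (hrow : ∀ x, ∑ y, ∑ z, |T₃ x y z| ≤ κ₃) (t : ℝ) (y₁ : ι') :
    ∑ y₂, ∑ y₃, |t ^ 3 * ∑ x ∈ Finset.univ.filter (fun x => β x = y₁), ∑ x' ∈ Finset.univ.filter (fun x' => β x' = y₂),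
        ∑ x'' ∈ Finset.univ.filter (fun x'' => β x'' = y₃), T₃ x x' x''| ≤ |t| ^ 3 * n * κ₃ := by
  have ht3 : 0 ≤ |t| ^ 3 := by positivity
  calc ∑ y₂, ∑ y₃, |t ^ 3 * ∑ x ∈ Finset.univ.filter (fun x => β x = y₁), ∑ x' ∈ Finset.univ.filter (fun x' => β x' = y₂),
          ∑ x'' ∈ Finset.univ.filter (fun x'' => β x'' = y₃), T₃ x x' x''|
      ≤ ∑ y₂, ∑ y₃, |t| ^ 3 * ∑ x ∈ Finset.univ.filter (fun x => β x = y₁), ∑ x' ∈ Finset.univ.filter (fun x' => β x' = y₂),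
          ∑ x'' ∈ Finset.univ.filter (fun x'' => β x'' = y₃), |T₃ x x' x''| := by
        refine Finset.sum_le_sum fun y₂ _ => Finset.sum_le_sum fun y₃ _ => ?_
        rw [abs_mul, abs_pow]
        refine mul_le_mul_of_nonneg_left ?_ ht3
        refine (Finset.abs_sum_le_sum_abs _ _).trans (Finset.sum_le_sum fun x _ => ?_)
        exact (Finset.abs_sum_le_sum_abs _ _).trans (Finset.sum_le_sum fun x' _ => Finset.abs_sum_le_sum_abs _ _)
    _ = |t| ^ 3 * ∑ y₂, ∑ y₃, ∑ x ∈ Finset.univ.filter (fun x => β x = y₁), ∑ x' ∈ Finset.univ.filter (fun x' => β x' = y₂),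
          ∑ x'' ∈ Finset.univ.filter (fun x'' => β x'' = y₃), |T₃ x x' x''| := by
        rw [Finset.mul_sum]
        exact Finset.sum_congr rfl fun y₂ _ => by rw [Finset.mul_sum]
    _ = |t| ^ 3 * ∑ x ∈ Finset.univ.filter (fun x => β x = y₁), ∑ y₂, ∑ x' ∈ Finset.univ.filter (fun x' => β x' = y₂), ∑ y₃,
          ∑ x'' ∈ Finset.univ.filter (fun x'' => β x'' = y₃), |T₃ x x' x''| := by
        congr 1
        calc ∑ y₂, ∑ y₃, ∑ x ∈ Finset.univ.filter (fun x => β x = y₁), ∑ x' ∈ Finset.univ.filter (fun x' => β x' = y₂),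
              ∑ x'' ∈ Finset.univ.filter (fun x'' => β x'' = y₃), |T₃ x x' x''|
            = ∑ y₂, ∑ x ∈ Finset.univ.filter (fun x => β x = y₁), ∑ y₃, ∑ x' ∈ Finset.univ.filter (fun x' => β x' = y₂),
              ∑ x'' ∈ Finset.univ.filter (fun x'' => β x'' = y₃), |T₃ x x' x''| := Finset.sum_congr rfl fun y₂ _ => Finset.sum_comm
          _ = ∑ x ∈ Finset.univ.filter (fun x => β x = y₁), ∑ y₂, ∑ y₃, ∑ x' ∈ Finset.univ.filter (fun x' => β x' = y₂),
              ∑ x'' ∈ Finset.univ.filter (fun x'' => β x'' = y₃), |T₃ x x' x''| := Finset.sum_comm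
          _ = ∑ x ∈ Finset.univ.filter (fun x => β x = y₁), ∑ y₂, ∑ x' ∈ Finset.univ.filter (fun x' => β x' = y₂), ∑ y₃,
              ∑ x'' ∈ Finset.univ.filter (fun x'' => β x'' = y₃), |T₃ x x' x''| :=
              Finset.sum_congr rfl fun x _ => Finset.sum_congr rfl fun y₂ _ => Finset.sum_comm
    _ = |t| ^ 3 * ∑ x ∈ Finset.univ.filter (fun x => β x = y₁), ∑ x', ∑ x'', |T₃ x x' x''| := by
        congr 1
        refine Finset.sum_congr rfl fun x _ => ?_
        have inner : ∀ x', ∑ y₃, ∑ x'' ∈ Finset.univ.filter (fun x'' => β x'' = y₃), |T₃ x x' x''| = ∑ x'', |T₃ x x' x''| := fun x' =>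
          Finset.sum_fiberwise Finset.univ β fun x'' => |T₃ x x' x''|
        simp only [inner]
        exact Finset.sum_fiberwise Finset.univ β fun x' => ∑ x'', |T₃ x x' x''|
    _ ≤ |t| ^ 3 * ∑ x ∈ Finset.univ.filter (fun x => β x = y₁), κ₃ := by
        gcongr with x _
        exact hrow x
    _ = |t| ^ 3 * ((Finset.univ.filter fun x => β x = y₁).card * κ₃) := by rw [Finset.sum_const, nsmul_eq_mul]
    _ ≤ |t| ^ 3 * (n * κ₃) := mul_le_mul_of_nonneg_left (mul_le_mul_of_nonneg_right (by exact_mod_cast hfib y₁) hκ₃) ht3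
    _ = |t| ^ 3 * n * κ₃ := by ring

/-! ## §6. Toy -/

/-- Toy (kernel): the identity kernel on `Fin 2` has row sums `≤ 1`. -/
example : ∀ x : Fin 2, ∑ y : Fin 2, |(if x = y then (1 : ℝ) else 0)| ≤ 1 := by
  intro x
  fin_cases x <;> simp

end Summit.QuantumFields.BalabanUV.T4Continuum.NE7b.SupKernelLetterTransport

end
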